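import Literature.NumberTheory.EllipticCurves.BSDSelmerSmithIsogenyTrickProofs
import Literature.NumberTheory.EllipticCurves.SelmerDivisiblePartIsogenyProofs
import Literature.NumberTheory.EllipticCurves.SelmerCorankControlCoinvariantsProofs
import HarnessLib

/-!
# Smith's isogeny trick on the tree's objects: Prop. 1.18 in the twist family, Thm. 1.7 from Thm. 1.17 (arXiv:2503.17619, §1.2)

A `…Proofs` companion (theorems only: no definition, no named fact, no instance) of
`Literature.NumberTheory.EllipticCurves.BSDSelmer` §bsd.S34 (`smith_selmerCorank_density`:
A. Smith, *The Birch and Swinnerton-Dyer conjecture implies Goldfeld's conjecture*,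
arXiv:2503.17619 (2025), Thm. 1.1), continuing `BSDSelmerSmithIsogenyTrickProofs`.

That file proves the deduction "Thm. 1.17 for `E` and for `E₀` + Prop. 1.18 ⇒ Thm. 1.7" of §1.2
with the quantities `r_{φ,div}(E^d)` of Def. 1.16 replaced by arbitrary functions `a b : ℤ → ℕ`
constrained by the identity of Prop. 1.18 (hypothesis `h₁₈`). Since then the tree has acquired
the objects of Def. 1.16 (`SelmerPInftyIsogeny`: `φ_*` on `H¹(K, E[p^∞])`, `Sel_div`,
`selmerDivRank` = `r_{φ,div}`, and `Isogeny.twistDivRank φ d = r_{φ,div}(E^d)` through the twisted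
isogeny `φ^d : E^d → E₀^d` of `IsogenyQuadraticTwistProofs`) and a proof of Prop. 1.18 for an
isogeny `φ : E → E'` of elliptic curves over a number field with `ψ ∘ φ = [p]`
(`SelmerDivisiblePartIsogenyProofs`: `Isogeny.selmerCorank_eq_divRank_add_divRank`, whose
docstring defers the application "to the twists `E^d`, `E₀^d` and the twisted isogenies at
`p = 2`" to this companion). This file makes the §1.2 deduction **concrete**:

* `Isogeny.quadraticTwist_quadraticTwist_apply_of_comp_eq_zsmul` — twisting isogenies is
  compatible with `ψ ∘ φ = [n]`: `ψ^d ∘ φ^d = [n]` (so the twist of the dual of a degree-`2`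
  isogeny is again a "dual": `φ'^d ∘ φ^d = [2]`);
* `selmerCorankTwoInfty_quadraticTwist_eq_twistDivRank_add` — **Prop. 1.18 as printed**: for a
  `ℚ`-isogeny `φ : E → E₀` with `φ' ∘ φ = [2]` (`φ'` the dual of the degree-`2` isogeny `φ`) and
  `d ∈ ℤ ∖ {0}`, `r_{2^∞}(E^d) = r_{2^∞}(E₀^d) = r_{φ,div}(E^d) + r_{φ',div}(E₀^d)`;
* `twistDensity_selmerCorankTwoInfty_le_one_of_thm117` (Case IV shape) and `…_of_thm117₂`
  (Case V shape) — **the proof of Thm. 1.7 (§1.2, pp. 5–6 of the source)** with Prop. 1.18 now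
  *used*, not assumed: the only hypotheses left are the printed conclusions of **Thm. 1.17** for
  `E` (with `φ`, resp. `φ₁, φ₂`) and for the isogenous curve(s) (with the dual isogenies), stated
  on the tree's `r_{2^∞}` (`selmerCorankTwoInfty`) and `r_{φ,div}(E^d)` (`Isogeny.twistDivRank`);
  the conclusion is "`r_{2^∞}(E^d) ≤ 1` for `100 %` of the squarefree `d`", the core of Thm. 1.7;
* `smith_selmerCorank_density_of_thm117`, `smith_selmerCorank_density_of_thm117₂` — hence,
  granted the Modularity Theorem and Monsky's `2`-parity congruence (the tree's route to the
  parity half of Thm. 1.1, `smith_selmerCorank_density_of_le_one`), Smith's Thm. 1.1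
  (`smith_selmerCorank_density`) for `E` and for the isogenous curve(s).

Models. The twisted isogeny `Isogeny.quadraticTwist` is constructed in the tree for models with
`a₁ = a₃ = 0` (`WeierstrassCurve.IsCharNeTwoNF`), which covers Smith's `E : y² = x³ + ax + b`
(Notation 1.8, `E^d : y² = x³ + d²ax + d³b`); the statements below carry these instance
hypotheses. For other models of the same curves Thm. 1.1 transfers by
`smith_selmerCorank_density_iff_of_isIsogenous` / `smith_selmerCorank_density_smul_iff`.

Scope, stated plainly. Nothing here proves Thm. 1.17 (§§2–6 of the source: the modified
higher-Selmer machinery of [Smi22a], Thm. 2.4; Tamagawa ratios, §3; `2`-Selmer moments in grids,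
§4; moments-to-ranks, §5), nothing here touches Cases I–II ([Smi22a]) or the case split of
Def. 1.6 ([Chil21] for Case V), and Thm. 1.1 itself remains the cited named fact
`smith_selmerCorank_density`. What the file settles is that, on the tree's definitions, Thm. 1.7
for a curve with a degree-`2` `ℚ`-isogeny is *exactly* as hard as the printed Thm. 1.17 for the
curve and its isogenous partner(s).

## References

* [arXiv250317619] A. Smith, *The Birch and Swinnerton-Dyer conjecture implies Goldfeld's
  conjecture*, arXiv:2503.17619 (2025): §1.1 (Def. 1.6, Thm. 1.7, Notation 1.8), §1.2 (Def. 1.16,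
  Thm. 1.17, Prop. 1.18 with proof, proof of Thm. 1.7).
* [Smi22a] A. Smith, *The distribution of `ℓ^∞`-Selmer groups in degree `ℓ` twist families I*,
  arXiv:2207.05674 (2022).
* [Chil21] G. Chiloyan, Á. Lozano-Robledo, *A classification of isogeny-torsion graphs of
  `ℚ`-isogeny classes of elliptic curves*, Trans. London Math. Soc. 8 (2021), 1–34 (cited in the
  source, proof of Thm. 1.7, for "`E₀` is in Case IV").
* J. E. Cremona, *Algorithms for Modular Elliptic Curves*, 2nd ed. (1997), §3.9 (twisting commutes
  with isogenies). [CremonaAlgorithms1997]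
-/

noncomputable section

open scoped Classical

universe u

/-! ## Twisting is compatible with `ψ ∘ φ = [n]` -/

namespace WeierstrassCurve.Isogeny

variable {F : Type u} [Field F] [NeZero (2 : F)] {V V' : WeierstrassCurve F} [V.IsCharNeTwoNF]
  [V'.IsCharNeTwoNF] {d : F}

/-- **Twisting isogenies is compatible with composition to `[n]`**: for isogenies `φ : V → V'`,
`ψ : V' → V` over `F` (models with `a₁ = a₃ = 0`) with `ψ ∘ φ = [n]` on `F̄`-points and
`d ∈ F^*`, the twisted isogenies satisfy `ψ^{(d)} ∘ φ^{(d)} = [n]` on `V^{(d)}(F̄)`: with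
`ι : V^{(d)}(F̄) ≃+ V(F̄)` the untwisting isomorphism, `ψ^{(d)} ∘ φ^{(d)} = ι⁻¹ ∘ ψ ∘ ι' ∘ ι'⁻¹ ∘ φ ∘ ι
= ι⁻¹ ∘ [n] ∘ ι = [n]`. In particular the twist of the dual `φ'` of a degree-`2` isogeny `φ`
satisfies `φ'^{(d)} ∘ φ^{(d)} = [2]` (Smith, arXiv:2503.17619, §1.2: the maps
`Sel_div E^d →(φ) Sel_div E₀^d →(φ') Sel_div E^d` compose to multiplication by `2`).
Cremona, *Algorithms*, §3.9. [folklore] -/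
theorem quadraticTwist_quadraticTwist_apply_of_comp_eq_zsmul (φ : Isogeny V V') (ψ : Isogeny V' V)
    (hd : d ≠ 0) {n : ℤ} (h : ∀ P : V.geomPoints, ψ (φ P) = n • P)
    (P : (V.quadraticTwist d).geomPoints) :
    ψ.quadraticTwist hd (φ.quadraticTwist hd P) = n • P := by
  rw [quadraticTwist_apply, quadraticTwist_apply, AddEquiv.apply_symm_apply, h, map_zsmul,
    AddEquiv.symm_apply_apply]

end WeierstrassCurve.Isogeny

namespace Literature.NumberTheory.EllipticCurves

open WeierstrassCurve Literature.NumberTheory.EllipticCurves.ModularForms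

variable {W W₀ W₁ W₂ : WeierstrassCurve ℚ}

/-! ## Prop. 1.18 in the quadratic twist family -/

section Prop118

variable [W.IsCharNeTwoNF] [W₀.IsCharNeTwoNF]

/-- **Smith's Prop. 1.18, as printed** (arXiv:2503.17619, §1.2): *"Choose a `ℚ`-isogeny
`φ : E → E₀` of degree `2` and a nonzero integer `d`, and take `φ' : E₀ → E` to be the dual
isogeny to `φ`. Then `r_{2^∞}(E^d) = r_{2^∞}(E₀^d) = r_{φ,div}(E^d) + r_{φ',div}(E₀^d)`."* Here
`E = W`, `E₀ = W₀` are elliptic curves over `ℚ` given by models with `a₁ = a₃ = 0`, `φ'` is any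
`ℚ`-isogeny with `φ' ∘ φ = [2]` (the dual of the degree-`2` isogeny `φ`, Silverman III.6.1),
`r_{2^∞}(E^d)` is the tree's `selmerCorankTwoInfty (W.quadraticTwist d)` and `r_{φ,div}(E^d)`,
`r_{φ',div}(E₀^d)` are `φ.twistDivRank d`, `φ'.twistDivRank d` (Def. 1.16 through the twisted
isogenies `φ^d : E^d → E₀^d`, `φ'^d : E₀^d → E^d`). Proof: the tree's Prop. 1.18 for isogenies of
elliptic curves over a number field (`Isogeny.selmerCorank_eq_divRank_add_divRank`, from the
factorisation `[2] = φ'_* ∘ φ_*` on `Sel_div ≅ (ℚ₂/ℤ₂)^r`) applied at `p = 2` to `φ^d`, `φ'^d`,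
which satisfy `φ'^d ∘ φ^d = [2]` (`Isogeny.quadraticTwist_quadraticTwist_apply_of_comp_eq_zsmul`);
`Sel_{2^∞}(E^d)[2]` is finite (`WeierstrassCurve.finite_torsionBy_selmerGroupPInfty`).
[cite: arXiv250317619, Prop. 1.18] -/
theorem selmerCorankTwoInfty_quadraticTwist_eq_twistDivRank_add [W.IsElliptic] [W₀.IsElliptic]
    (φ : Isogeny W W₀) (φ' : Isogeny W₀ W) (hφ'φ : ∀ P : W.geomPoints, φ' (φ P) = (2 : ℤ) • P)
    {d : ℤ} (hd : d ≠ 0) :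
    selmerCorankTwoInfty (W.quadraticTwist d) = φ.twistDivRank d + φ'.twistDivRank d ∧
      selmerCorankTwoInfty (W₀.quadraticTwist d) = φ.twistDivRank d + φ'.twistDivRank d := by
  have hd' : (d : ℚ) ≠ 0 := by exact_mod_cast hd
  haveI := W.isElliptic_quadraticTwist (d := (d : ℚ)) hd'
  haveI := W₀.isElliptic_quadraticTwist (d := (d : ℚ)) hd'
  haveI := (W.quadraticTwist (d : ℚ)).finite_torsionBy_selmerGroupPInfty (p := 2)
  haveI := (W₀.quadraticTwist (d : ℚ)).finite_torsionBy_selmerGroupPInfty (p := 2)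
  rw [selmerCorankTwoInfty_eq, selmerCorankTwoInfty_eq, Isogeny.twistDivRank_of_ne_zero φ hd',
    Isogeny.twistDivRank_of_ne_zero φ' hd']
  exact (φ.quadraticTwist hd').selmerCorank_eq_divRank_add_divRank 2 (φ'.quadraticTwist hd')
    (Isogeny.quadraticTwist_quadraticTwist_apply_of_comp_eq_zsmul φ φ' hd' hφ'φ)

/-- Prop. 1.18, the identity for `E` alone: `r_{2^∞}(E^d) = r_{φ,div}(E^d) + r_{φ',div}(E₀^d)`
for `d ≠ 0` — the hypothesis `h₁₈` of `twistDensity_selmerCorankTwoInfty_le_one_of_isogenyTrick`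
with `a = r_{φ,div}`, `b = r_{φ',div}`. [cite: arXiv250317619, Prop. 1.18] -/
theorem selmerCorankTwoInfty_quadraticTwist_eq_twistDivRank_add' [W.IsElliptic] [W₀.IsElliptic]
    (φ : Isogeny W W₀) (φ' : Isogeny W₀ W) (hφ'φ : ∀ P : W.geomPoints, φ' (φ P) = (2 : ℤ) • P)
    (d : ℤ) (hd : d ≠ 0) :
    selmerCorankTwoInfty (W.quadraticTwist d) = φ.twistDivRank d + φ'.twistDivRank d :=
  (selmerCorankTwoInfty_quadraticTwist_eq_twistDivRank_add φ φ' hφ'φ hd).1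

end Prop118

/-! ## Thm. 1.7 from Thm. 1.17: the isogeny trick with Prop. 1.18 discharged -/

section Thm17

variable [W.IsCharNeTwoNF] [W₀.IsCharNeTwoNF] [W₁.IsCharNeTwoNF] [W₂.IsCharNeTwoNF]

/-- **Smith, arXiv:2503.17619, §1.2, proof of Thm. 1.7 (Case IV shape), on the tree's objects.**
Let `φ : E → E₀` be a `ℚ`-isogeny of elliptic curves (models with `a₁ = a₃ = 0`) and `φ'` a
`ℚ`-isogeny with `φ' ∘ φ = [2]` (in the source: `E` in Case IV, `φ` its unique balanced isogeny,
of degree `2`, `φ'` the dual isogeny — "it is also a balanced isogeny", and `E₀` is in Case IV).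
Assume the conclusion of **Thm. 1.17** for `E` with `φ` — *"for `100 %` of squarefree integers
`d`, either `r_{2^∞}(E^d) ≤ 1` or `r_{2^∞}(E^d) = r_{φ,div}(E^d) ≥ 2`"* (`h₁₇`) — and for `E₀`
with `φ'` (`h₁₇'`). Then **`r_{2^∞}(E^d) ≤ 1` for `100 %` of the squarefree `d`** (the core of
Thm. 1.7, to which Thm. 1.1 for `E` reduces: `smith_selmerCorank_density_iff_le_one_of_exists_isNewformOf`).
Proof as printed: Prop. 1.18 (`selmerCorankTwoInfty_quadraticTwist_eq_twistDivRank_add`,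
proved) turns the bad alternative for `E`, `r_{2^∞}(E^d) = r_{φ,div}(E^d) ≥ 2`, into
`r_{2^∞}(E₀^d) - r_{φ',div}(E₀^d) ≥ 2`, inconsistent with Thm. 1.17 for `E₀` off a density-`0`
set (`twistDensity_selmerCorankTwoInfty_le_one_of_isogenyTrick`).
[cite: arXiv250317619, §1.2 (Thm. 1.17, Prop. 1.18, proof of Thm. 1.7)] -/
theorem twistDensity_selmerCorankTwoInfty_le_one_of_thm117 [W.IsElliptic] [W₀.IsElliptic]
    (φ : Isogeny W W₀) (φ' : Isogeny W₀ W) (hφ'φ : ∀ P : W.geomPoints, φ' (φ P) = (2 : ℤ) • P)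
    (h₁₇ : twistDensity (fun d ↦ d ≠ 0 ∧
      (selmerCorankTwoInfty (W.quadraticTwist d) ≤ 1 ∨
        (selmerCorankTwoInfty (W.quadraticTwist d) = φ.twistDivRank d ∧
          2 ≤ φ.twistDivRank d))) 1)
    (h₁₇' : twistDensity (fun d ↦ d ≠ 0 ∧
      (selmerCorankTwoInfty (W₀.quadraticTwist d) ≤ 1 ∨
        (selmerCorankTwoInfty (W₀.quadraticTwist d) = φ'.twistDivRank d ∧
          2 ≤ φ'.twistDivRank d))) 1) :
    twistDensity (fun d ↦ d ≠ 0 ∧ selmerCorankTwoInfty (W.quadraticTwist d) ≤ 1) 1 :=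
  twistDensity_selmerCorankTwoInfty_le_one_of_isogenyTrick ⟨φ⟩ φ.twistDivRank φ'.twistDivRank
    (selmerCorankTwoInfty_quadraticTwist_eq_twistDivRank_add' φ φ' hφ'φ) h₁₇ h₁₇'

/-- The same conclusion for the isogenous curve `E₀`: under the hypotheses of
`twistDensity_selmerCorankTwoInfty_le_one_of_thm117`, `r_{2^∞}(E₀^d) ≤ 1` for `100 %` of the
squarefree `d` (`r_{2^∞}(E^d) = r_{2^∞}(E₀^d)`, Prop. 1.18, first equality).
[cite: arXiv250317619, §1.2 (Prop. 1.18, proof of Thm. 1.7)] -/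
theorem twistDensity_selmerCorankTwoInfty_le_one_of_thm117' [W.IsElliptic] [W₀.IsElliptic]
    (φ : Isogeny W W₀) (φ' : Isogeny W₀ W) (hφ'φ : ∀ P : W.geomPoints, φ' (φ P) = (2 : ℤ) • P)
    (h₁₇ : twistDensity (fun d ↦ d ≠ 0 ∧
      (selmerCorankTwoInfty (W.quadraticTwist d) ≤ 1 ∨
        (selmerCorankTwoInfty (W.quadraticTwist d) = φ.twistDivRank d ∧
          2 ≤ φ.twistDivRank d))) 1)
    (h₁₇' : twistDensity (fun d ↦ d ≠ 0 ∧
      (selmerCorankTwoInfty (W₀.quadraticTwist d) ≤ 1 ∨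
        (selmerCorankTwoInfty (W₀.quadraticTwist d) = φ'.twistDivRank d ∧
          2 ≤ φ'.twistDivRank d))) 1) :
    twistDensity (fun d ↦ d ≠ 0 ∧ selmerCorankTwoInfty (W₀.quadraticTwist d) ≤ 1) 1 :=
  (twistDensity_selmerCorankTwoInfty_le_one_iff_of_isIsogenous ⟨φ⟩).1
    (twistDensity_selmerCorankTwoInfty_le_one_of_thm117 φ φ' hφ'φ h₁₇ h₁₇')

/-- **Smith, arXiv:2503.17619, §1.2, proof of Thm. 1.7 (Case V shape), on the tree's objects.**
Let `φ₁ : E → E₁`, `φ₂ : E → E₂` be `ℚ`-isogenies of elliptic curves (models with `a₁ = a₃ = 0`)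
with `ℚ`-isogenies `φ₁'`, `φ₂'` such that `φᵢ' ∘ φᵢ = [2]` (in the source: `E` in Case V, `φ₁, φ₂`
its two distinct balanced isogenies, `φᵢ'` their duals; by [Chil21] the `Eᵢ` are in Case IV with
balanced isogeny `φᵢ'`). Assume the conclusion of **Thm. 1.17** for `E` in Case V — *"for `100 %`
of squarefree `d`, either `r_{2^∞}(E^d) ≤ 1` or `r_{2^∞}(E^d) = r_{φ₁,div}(E^d) ≥ 2` or
`r_{2^∞}(E^d) = r_{φ₂,div}(E^d) ≥ 2`"* (`h₁₇`) — and of Thm. 1.17 for `E₁` with `φ₁'` and for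
`E₂` with `φ₂'` (`h₁₇₁`, `h₁₇₂`). Then **`r_{2^∞}(E^d) ≤ 1` for `100 %` of the squarefree `d`**,
Prop. 1.18 for `φ₁` and `φ₂` being proved
(`selmerCorankTwoInfty_quadraticTwist_eq_twistDivRank_add`).
[cite: arXiv250317619, §1.2 (Thm. 1.17, Prop. 1.18, proof of Thm. 1.7)] -/
theorem twistDensity_selmerCorankTwoInfty_le_one_of_thm117₂
    [W.IsElliptic] [W₁.IsElliptic] [W₂.IsElliptic]
    (φ₁ : Isogeny W W₁) (φ₁' : Isogeny W₁ W) (hφ₁ : ∀ P : W.geomPoints, φ₁' (φ₁ P) = (2 : ℤ) • P)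
    (φ₂ : Isogeny W W₂) (φ₂' : Isogeny W₂ W) (hφ₂ : ∀ P : W.geomPoints, φ₂' (φ₂ P) = (2 : ℤ) • P)
    (h₁₇ : twistDensity (fun d ↦ d ≠ 0 ∧
      (selmerCorankTwoInfty (W.quadraticTwist d) ≤ 1 ∨
        (selmerCorankTwoInfty (W.quadraticTwist d) = φ₁.twistDivRank d ∧
          2 ≤ φ₁.twistDivRank d) ∨
        (selmerCorankTwoInfty (W.quadraticTwist d) = φ₂.twistDivRank d ∧
          2 ≤ φ₂.twistDivRank d))) 1)
    (h₁₇₁ : twistDensity (fun d ↦ d ≠ 0 ∧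
      (selmerCorankTwoInfty (W₁.quadraticTwist d) ≤ 1 ∨
        (selmerCorankTwoInfty (W₁.quadraticTwist d) = φ₁'.twistDivRank d ∧
          2 ≤ φ₁'.twistDivRank d))) 1)
    (h₁₇₂ : twistDensity (fun d ↦ d ≠ 0 ∧
      (selmerCorankTwoInfty (W₂.quadraticTwist d) ≤ 1 ∨
        (selmerCorankTwoInfty (W₂.quadraticTwist d) = φ₂'.twistDivRank d ∧
          2 ≤ φ₂'.twistDivRank d))) 1) :
    twistDensity (fun d ↦ d ≠ 0 ∧ selmerCorankTwoInfty (W.quadraticTwist d) ≤ 1) 1 :=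
  twistDensity_selmerCorankTwoInfty_le_one_of_isogenyTrick₂ ⟨φ₁⟩ ⟨φ₂⟩
    φ₁.twistDivRank φ₁'.twistDivRank φ₂.twistDivRank φ₂'.twistDivRank
    (selmerCorankTwoInfty_quadraticTwist_eq_twistDivRank_add' φ₁ φ₁' hφ₁)
    (selmerCorankTwoInfty_quadraticTwist_eq_twistDivRank_add' φ₂ φ₂' hφ₂) h₁₇ h₁₇₁ h₁₇₂

/-! ### With the parity half: Thm. 1.1 for `E` and for the isogenous curves -/

/-- **Thm. 1.17 (for `E`, `E₀`) ⇒ Thm. 1.7 ⇒ Thm. 1.1, Case IV shape, on the tree's objects.**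
Granted the Modularity Theorem (`hmod`) and Monsky's `2`-parity congruence (`hMon`), which supply
the parity half of Thm. 1.1 in the tree (`smith_selmerCorank_density_of_le_one`), the printed
conclusions of Thm. 1.17 for `E` (with a `ℚ`-isogeny `φ : E → E₀`) and for `E₀` (with `φ'`,
`φ' ∘ φ = [2]`) give Smith's Thm. 1.1 (`smith_selmerCorank_density`) for `E` and for `E₀`;
Prop. 1.18 is proved, not assumed. [cite: arXiv250317619, §1.2 (proof of Thm. 1.7) and Thm. 1.1] -/
theorem smith_selmerCorank_density_of_thm117 [W.IsElliptic] [W₀.IsElliptic]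
    (hmod : exists_isNewformOf) (hMon : monsky_selmerCorank_two_mod_two_eq)
    (φ : Isogeny W W₀) (φ' : Isogeny W₀ W) (hφ'φ : ∀ P : W.geomPoints, φ' (φ P) = (2 : ℤ) • P)
    (h₁₇ : twistDensity (fun d ↦ d ≠ 0 ∧
      (selmerCorankTwoInfty (W.quadraticTwist d) ≤ 1 ∨
        (selmerCorankTwoInfty (W.quadraticTwist d) = φ.twistDivRank d ∧
          2 ≤ φ.twistDivRank d))) 1)
    (h₁₇' : twistDensity (fun d ↦ d ≠ 0 ∧
      (selmerCorankTwoInfty (W₀.quadraticTwist d) ≤ 1 ∨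
        (selmerCorankTwoInfty (W₀.quadraticTwist d) = φ'.twistDivRank d ∧
          2 ≤ φ'.twistDivRank d))) 1) :
    smith_selmerCorank_density W ∧ smith_selmerCorank_density W₀ :=
  smith_selmerCorank_density_of_isogenyTrick hmod hMon ⟨φ⟩ φ.twistDivRank φ'.twistDivRank
    (selmerCorankTwoInfty_quadraticTwist_eq_twistDivRank_add' φ φ' hφ'φ) h₁₇ h₁₇'

/-- **Thm. 1.17 (for `E`, `E₁`, `E₂`) ⇒ Thm. 1.7 ⇒ Thm. 1.1, Case V shape, on the tree's
objects.** Granted Modularity and Monsky's congruence, the printed conclusions of Thm. 1.17 for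
`E` in Case V (with `ℚ`-isogenies `φᵢ : E → Eᵢ`, `i = 1, 2`) and for `E₁`, `E₂` (with `φᵢ'`,
`φᵢ' ∘ φᵢ = [2]`) give Smith's Thm. 1.1 for `E`, `E₁` and `E₂`; Prop. 1.18 is proved, not
assumed. [cite: arXiv250317619, §1.2 (proof of Thm. 1.7) and Thm. 1.1] -/
theorem smith_selmerCorank_density_of_thm117₂ [W.IsElliptic] [W₁.IsElliptic] [W₂.IsElliptic]
    (hmod : exists_isNewformOf) (hMon : monsky_selmerCorank_two_mod_two_eq)
    (φ₁ : Isogeny W W₁) (φ₁' : Isogeny W₁ W) (hφ₁ : ∀ P : W.geomPoints, φ₁' (φ₁ P) = (2 : ℤ) • P)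
    (φ₂ : Isogeny W W₂) (φ₂' : Isogeny W₂ W) (hφ₂ : ∀ P : W.geomPoints, φ₂' (φ₂ P) = (2 : ℤ) • P)
    (h₁₇ : twistDensity (fun d ↦ d ≠ 0 ∧
      (selmerCorankTwoInfty (W.quadraticTwist d) ≤ 1 ∨
        (selmerCorankTwoInfty (W.quadraticTwist d) = φ₁.twistDivRank d ∧
          2 ≤ φ₁.twistDivRank d) ∨
        (selmerCorankTwoInfty (W.quadraticTwist d) = φ₂.twistDivRank d ∧
          2 ≤ φ₂.twistDivRank d))) 1)
    (h₁₇₁ : twistDensity (fun d ↦ d ≠ 0 ∧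
      (selmerCorankTwoInfty (W₁.quadraticTwist d) ≤ 1 ∨
        (selmerCorankTwoInfty (W₁.quadraticTwist d) = φ₁'.twistDivRank d ∧
          2 ≤ φ₁'.twistDivRank d))) 1)
    (h₁₇₂ : twistDensity (fun d ↦ d ≠ 0 ∧
      (selmerCorankTwoInfty (W₂.quadraticTwist d) ≤ 1 ∨
        (selmerCorankTwoInfty (W₂.quadraticTwist d) = φ₂'.twistDivRank d ∧
          2 ≤ φ₂'.twistDivRank d))) 1) :
    smith_selmerCorank_density W ∧ smith_selmerCorank_density W₁ ∧
      smith_selmerCorank_density W₂ :=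
  smith_selmerCorank_density_of_isogenyTrick₂ hmod hMon ⟨φ₁⟩ ⟨φ₂⟩
    φ₁.twistDivRank φ₁'.twistDivRank φ₂.twistDivRank φ₂'.twistDivRank
    (selmerCorankTwoInfty_quadraticTwist_eq_twistDivRank_add' φ₁ φ₁' hφ₁)
    (selmerCorankTwoInfty_quadraticTwist_eq_twistDivRank_add' φ₂ φ₂' hφ₂) h₁₇ h₁₇₁ h₁₇₂

end Thm17

end Literature.NumberTheory.EllipticCurves

end
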